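import Literature.MathematicalPhysics.QuantumFieldTheory.Balaban1983to89.B8Ineq159FlatCubeMemberPrintedRec
import Literature.MathematicalPhysics.QuantumFieldTheory.Balaban1983to89.B8LambdaSpaceKLevel
import Mathlib.LinearAlgebra.Matrix.NonsingularInverse

/-!
# `Balaban1983to89.B8Real123FlatTranslateRec` — [Balaban1985RegularSpaces] (1.91)–(1.92), (1.98), (1.101) (= [Balaban1985BackgroundPropagators] THEOREMS 3.1–3.2 AT
# `U = 1`) IN THE p6 FLAT CONSUMER's NORMALISATION: the three REAL inequality families as ONE predicate `Real123Block` (generic in the block-label map, the site tower and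
# the cells), and their TRANSLATION COVARIANCE `real123Block_translate` — ENGINE corner labels `blockMap (Lʲ)` on the translated tower ⟹ RECORD centred labels `flmZ L j`
# ([Balaban1987RG1] (0.3)) on the original tower

statement-level skeleton of published theorems with citation tags; proofs where landed; nothing here is a claim about the Yang–Mills mass gap

CITATION HEADER (lean-in-tree rule).  Cell `pub-ymgap` (HUMAN RULING D-0062), «N05-REC» road (director-ym №254∕№255; LEAD PEN dag-n05-e g38; desk `R6-PLAN.md` §2 row (e)′-3).
[6] = [Balaban1985RegularSpaces] (1.91)–(1.92) p. 91, (1.98) p. 92, (1.101) p. 93, (1.5)–(1.6) p. 77; [4] = [Balaban1985BackgroundPropagators] Thm 3.1 (3.47) p. 398, Thm 3.2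
(3.48) p. 398, (3.23)–(3.25) p. 394; [15] = [Balaban1985Variational] (148)–(151) p. 301; [I] = [Balaban1987RG1] (0.3) p. 252 (CENTRED blocks «Bᵏ(y) = {x : |x_μ − Lᵏy_μ| ≤
(Lᵏ−1)∕2}»).  `--kind definition --supports stmt-QuantumFields-20541` (K0⁷; count-neutral).
WHY THIS FILE.  The engine's Prop-6 crowns (`B8Prop6CubeMemberScalarGamma*`, `B8Prop6DentedCubeMemberScalarGamma*`) consume the flat consumer's THREE REAL inequality families
((1.91)–(1.92) for `T⁻¹`, (1.101) for `T⁻¹T⁻¹Qᵀ(QT⁻²Qᵀ)⁻¹`, (1.98) for `1 − T⁻¹Qᵀ(QT⁻²Qᵀ)⁻¹QT⁻¹`, on the explicit matrices `T`, `Q` of a site tower `{D_j}` with cells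
`{Λ_j}` and block labels `x ↦ ⌊x∕Lʲ⌋`) at every truncation — PROVED in the tree for the pure member (dag-n05-c `B8Thm32GBoundCubeMemberHolds.prop6_real123_printed`) and for the
dented member (`B8Real123DentedCubeMember` + `B8Prop6DentedCubeMemberScalarGammaOfGBound.real123Dented_of_real1_gbound` + the dented parametrix ∕ 𝒢-bound files).  The
RECORD's averaging ([I] (0.3)) labels blocks by the CENTRED map `flmZ L j`; for the SAME datum the record tower is the engine tower translated (fine sites by `c_k =
ctrShift L k`, level-`j` labels by `c_{k−j}`; `flm L j (x + c_k) = flmZ L j x + c_{k−j}`, dag-n07-w3's `B8Eq131CubesRecDictionary.flm_add_ctrShift`).  Every letter of the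
three families is a finite sum over sites ∕ cells and a translation-invariant stencil, so the record block follows from the engine block by REINDEXING the finite index
sets (`S ↦ S + c_k`, `(j, y) ↦ (j, y + c_{k−j})`): the matrices of the translated tower are the `Matrix.submatrix` of the record's along these bijections, inverses and
products commute with `submatrix` (`Matrix.inv_submatrix_equiv`, `Matrix.submatrix_mul_equiv`), and the sup ∕ gradient ∕ Laplacian bounds are read back at the shifted
site.  ONE predicate (§1) names the block once for all three consumers (pure record member, dented record member, the record γ-crown's hypothesis); ONE theorem (§2)
does the transfer.  Consumers: `B8Real123CubeMemberRec` (the record twins of `prop6_real123_printed` and of `Real123DentedCubeMemberPrinted`, both UNCONDITIONAL).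
WHAT IS PROVED (sorry-free).  §1 def ★ `Real123Block L lab η n w D Λ BG B₀'H B₂' BR` — the REAL-1 ∧ REAL-2 ∧ REAL-3 block of the γ-crown's hypothesis VERBATIM
(`B8Prop6DentedCubeMemberScalarGamma.gaugedBoundB8D_dentedMember_scalar_γ`, per truncation), generic in the label map `lab : ℕ → Site → Site`, the tower `D`, the cells
`Λ`, the weights `w`.  §2 ★★ `real123Block_translate` (odd `L`, `n ≤ k`): the block for `(fun j => blockMap (Lʲ), D + c_k, Λ_j + c_{k−j})` implies the block for
`(flmZ L, D, Λ)`, same constants.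
HONEST SCOPE.  Finite reindexing bookkeeping at the flat background; no estimate; nothing of [4]∕[6]∕[15]∕[I] newly asserted; `HThm4Rec` UNDISCHARGED; N05 ∕ N07 NOT
discharged; counts unmoved (typed 28∕28 · discharged 8∕28); one finite 𝕋⁴ programme at fixed ε — nothing continuum ∕ ℝ⁴ ∕ OS ∕ mass gap ∕ Clay.  No `instance`, no
`notation`, no `sorry`.
-/

set_option autoImplicit false
noncomputable section
open scoped BigOperators Matrix

namespace Literature.MathematicalPhysics.QuantumFieldTheory.Balaban1983to89.B8Real123FlatTranslateRec

open B7Prop1Explicit (e)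
open B8Eq140Level (SideTouches)
open B8LambdaSpaceKLevel (wt)
open BlockAveragingZd (ctrShift)
open Literature.MathematicalPhysics.QuantumLattice (blockMap)
open B8Eq131Cubes (flm)
open B8Eq119TwistedAxialRec (flmZ)
open B8Eq131CubesRecDictionary (flm_add_ctrShift)
open B8Ineq159FlatCubeMemberPrintedRec (sideTouches_image_add_iff)

variable {d : ℕ}

/-! ## §1 The three REAL inequality families of the flat p6 consumer, as one predicate -/

open Classical in
/-- **[Balaban1985RegularSpaces] (1.91)–(1.92), (1.101), (1.98) AT `U = 1` IN THE FLAT p6 CONSUMER's NORMALISATION, AS ONE PREDICATE** ([4] Theorems 3.1–3.2 read on a site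
tower): for the site tower `{D_j}_{j ≤ n}` (`D 0 = Ω₀` the region), the cells `{Λ_j}_{j ≤ n}` (level-`j` labels), the block-label map `lab j : Site → Site` (engine: corner
labels `x ↦ ⌊x∕Lʲ⌋ = blockMap (Lʲ)`; record: centred labels `flmZ L j`, [I] (0.3)), the weights `w j` of `Q*aQ` and the four constants — for every presentation of the data
as finite index sets `S` (`= D 0`), `B` (`= {(j, y) : j ≤ n, y ∈ Λ_j}`), the kernel `K` (flat `Δ^η` plus `Σ_j w_j (L^{−dj})² [lab_j x ∈ Λ_j][lab_j z = lab_j x]`) and the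
matrices `T = (K)`, `Q = (L^{−dj}[lab_j z = y])`: REAL-1 ((1.91)–(1.92): `φ = T⁻¹ρ′` has `|φ| ≤ B_G·r` and `(Lʲη)|∂^ηφ| ≤ B_G·r` on the sides touching `D_j` whenever
`(Lʲη)²|ρ′| ≤ r` on `D_j`), REAL-2 ((1.101): `φ = T⁻¹T⁻¹Qᵀ(QT⁻²Qᵀ)⁻¹X` has `|φ|, (Lʲη)|∂^ηφ| ≤ B′₀ᴴ·s`, `(Lʲη)²|Δ^ηφ| ≤ B′₂·s` whenever `|X| ≤ s`), REAL-3 ((1.98):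
`(Lʲη)²|(1 − T⁻¹Qᵀ(QT⁻²Qᵀ)⁻¹QT⁻¹)ρ′| ≤ B_R·r` on `D_j`).  VERBATIM the per-truncation REAL hypothesis of the γ-crown
`B8Prop6DentedCubeMemberScalarGamma.gaugedBoundB8D_dentedMember_scalar_γ` with `blockMap (L ^ j) ↦ lab j`, `c.sq ↦ D`, `c.lamST n ↦ Λ`.  A predicate (named shape), not an
assertion. [cite: Balaban1985RegularSpaces, (1.91)–(1.92) p.91, (1.98) p.92, (1.101) p.93; Balaban1985BackgroundPropagators, Theorem 3.1 (3.47) p.398, Theorem 3.2 (3.48) p.398, (3.23)–(3.25) p.394; Balaban1987RG1, (0.3) p.252] -/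
def Real123Block (L : ℕ) (lab : ℕ → (Fin d → ℤ) → (Fin d → ℤ)) (η : ℝ) (n : ℕ) (w : ℕ → ℝ) (D Λ : ℕ → Set (Fin d → ℤ))
    (BG B₀'H B₂' BR : ℝ) : Prop :=
  ∀ (S : Finset (Fin d → ℤ)), (∀ z, z ∈ S ↔ z ∈ D 0) →
  ∀ (B : Finset (ℕ × (Fin d → ℤ))), (∀ p, p ∈ B ↔ p.1 ≤ n ∧ p.2 ∈ Λ p.1) →
  ∀ (K : (Fin d → ℤ) → (Fin d → ℤ) → ℝ), (∀ x z, K x z =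
      ((η ^ 2)⁻¹ * ∑ μ : Fin d, ((2 : ℝ) * (if z = x then (1 : ℝ) else 0) - (if z = x + e μ then (1 : ℝ) else 0)
        - (if z = x - e μ then (1 : ℝ) else 0))) +
      (∑ j ∈ Finset.range (n + 1), (if lab j x ∈ Λ j ∧ lab j z = lab j x then
        w j * ((((L : ℝ) ^ d)⁻¹) ^ j) ^ 2 else 0))) →
  ∀ (T : Matrix ↥S ↥S ℝ), T = Matrix.of (fun x z : ↥S => K x.1 z.1) →
  ∀ (Q : Matrix ↥B ↥S ℝ), Q = Matrix.of (fun (p : ↥B) (z : ↥S) =>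
      if lab p.1.1 z.1 = p.1.2 then ((((L : ℝ)) ^ d)⁻¹) ^ p.1.1 else 0) →
  -- REAL-1: (1.91)–(1.92) for `T⁻¹`
  (∀ (ρ' : ↥S → ℝ) (r : ℝ), 0 ≤ r →
    (∀ j, j ≤ n → ∀ z : ↥S, z.1 ∈ D j → wt L η j ^ 2 * |ρ' z| ≤ r) →
    ∀ φ : (Fin d → ℤ) → ℝ, (∀ x, x ∉ D 0 → φ x = 0) →
      (∀ v : ↥S, φ v.1 = ∑ z : ↥S, T⁻¹ v z * ρ' z) →
      (∀ x, |φ x| ≤ BG * r) ∧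
      ∀ j, j ≤ n → ∀ p ∈ {b : (Fin d → ℤ) × Fin d | SideTouches (D j) b.1 b.2},
        wt L η j * |η⁻¹ * (φ (p.1 + e p.2) - φ p.1)| ≤ BG * r) ∧
  -- REAL-2: (1.101) for `T⁻¹T⁻¹Qᵀ(QT⁻²Qᵀ)⁻¹`
  (∀ (X : ↥B → ℝ) (s : ℝ), 0 ≤ s → (∀ p', |X p'| ≤ s) →
    ∀ φ : (Fin d → ℤ) → ℝ, (∀ x, x ∉ D 0 → φ x = 0) →
      (∀ v : ↥S, φ v.1 = ∑ p' : ↥B, (T⁻¹ * (T⁻¹ * Qᵀ) * (Q * T⁻¹ * T⁻¹ * Qᵀ)⁻¹) v p' * X p') →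
      (∀ x, |φ x| ≤ B₀'H * s) ∧
      (∀ j, j ≤ n → ∀ p ∈ {b : (Fin d → ℤ) × Fin d | SideTouches (D j) b.1 b.2},
        wt L η j * |η⁻¹ * (φ (p.1 + e p.2) - φ p.1)| ≤ B₀'H * s) ∧
      (∀ j, j ≤ n → ∀ x ∈ D j,
        wt L η j ^ 2 * |∑ μ : Fin d, (η ^ 2)⁻¹ * (2 * φ x - φ (x + e μ) - φ (x - e μ))| ≤ B₂' * s)) ∧
  -- REAL-3: (1.98) for `1 − T⁻¹Qᵀ(QT⁻²Qᵀ)⁻¹QT⁻¹`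
  (∀ (ρ' : ↥S → ℝ) (r : ℝ), 0 ≤ r →
    (∀ j, j ≤ n → ∀ z : ↥S, z.1 ∈ D j → wt L η j ^ 2 * |ρ' z| ≤ r) →
    ∀ j, j ≤ n → ∀ v : ↥S, v.1 ∈ D j →
      wt L η j ^ 2 * |ρ' v - ∑ z : ↥S, (T⁻¹ * (Qᵀ * ((Q * T⁻¹ * T⁻¹ * Qᵀ)⁻¹ * (Q * T⁻¹)))) v z * ρ' z| ≤ BR * r)

/-! ## §2 Translation covariance: engine labels on the translated tower ⟹ record labels on the tower -/

/-- `x + t ∈ S + t ↔ x ∈ S`. [folklore] [cite: Balaban1987RG1, (0.3) p.252 (bookkeeping)] -/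
private theorem add_mem_image_add_iff (S : Set (Fin d → ℤ)) (t x : Fin d → ℤ) : x + t ∈ (fun y => y + t) '' S ↔ x ∈ S :=
  ⟨fun ⟨y, hy, h⟩ => by rwa [← add_right_cancel h], fun hx => ⟨x, hx, rfl⟩⟩

/-- `x ∈ S + t ↔ x − t ∈ S`. [folklore] [cite: Balaban1987RG1, (0.3) p.252 (bookkeeping)] -/
private theorem mem_image_add_iff (S : Set (Fin d → ℤ)) (t x : Fin d → ℤ) : x ∈ (fun y => y + t) '' S ↔ x - t ∈ S := by
  rw [← add_mem_image_add_iff S t (x - t), sub_add_cancel]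

/-- The prelude's block map at block size `Lʲ` is `flm L j`. [folklore] [cite: Balaban1985RegularSpaces, (1.6) p.77] -/
private theorem blockMap_pow_eq_flm (L j : ℕ) (x : Fin d → ℤ) : blockMap (L ^ j) x = flm L j x := by
  funext i; simp [blockMap, flm]

/-- Two `if`s with equivalent conditions and equal branches agree (any `Decidable` instances). [folklore] -/
private theorem ite_eq_ite_of_iff {P P' : Prop} [Decidable P] [Decidable P'] (h : P ↔ P') (a b : ℝ) :
    (if P then a else b) = (if P' then a else b) := by
  by_cases hP : P
  · rw [if_pos hP, if_pos (h.1 hP)]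
  · rw [if_neg hP, if_neg (mt h.2 hP)]

/-- ★★ **TRANSLATION COVARIANCE OF THE THREE REAL FAMILIES** (odd `L`, truncation `n ≤ k`): if REAL-1∕2∕3 hold for the TRANSLATED tower `D_j + c_k·𝟙`, translated cells
`Λ_j + c_{k−j}·𝟙` and the ENGINE's corner labels `x ↦ ⌊x∕Lʲ⌋`, then they hold, with the same constants, for `D`, `Λ` and the RECORD's centred labels `flmZ L j`.  Proof:
present the translated data on the index sets `S + c_k`, `{(j, y + c_{k−j})}` with the kernel `K(· − c_k, · − c_k)`; its matrices are `T`, `Q` reindexed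
(`Matrix.submatrix`) along the two bijections (`flm L j (x + c_k) = flmZ L j x + c_{k−j}`); inverses ∕ products ∕ transposes commute with the reindexing; the functions
`φ(· − c_k)`, `ρ′`, `X` reindexed satisfy the translated hypotheses, and the translated conclusions at `x + c_k` are the record's at `x` (the stencils `∂^η`, `Δ^η` and
`SideTouches` are translation-covariant). [cite: Balaban1985RegularSpaces, (1.91)–(1.92) p.91, (1.98) p.92, (1.101) p.93, (1.6) p.77; Balaban1985BackgroundPropagators, Theorem 3.1 (3.47) p.398, Theorem 3.2 (3.48) p.398; Balaban1987RG1, (0.3) p.252] -/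
theorem real123Block_translate {L : ℕ} (hL : Odd L) {k n : ℕ} (hnk : n ≤ k) {η : ℝ} {w : ℕ → ℝ} {D Λ : ℕ → Set (Fin d → ℤ)}
    {BG B₀'H B₂' BR : ℝ}
    (h : Real123Block L (fun j => blockMap (L ^ j)) η n w
      (fun j => (fun x : Fin d → ℤ => x + fun _ => (ctrShift L k : ℤ)) '' D j)
      (fun j => (fun z : Fin d → ℤ => z + fun _ => (ctrShift L (k - j) : ℤ)) '' Λ j) BG B₀'H B₂' BR) :
    Real123Block L (flmZ L) η n w D Λ BG B₀'H B₂' BR := by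
  classical
  intro S hS B hB K hK T hT Q hQ
  -- the translation vectors: fine sites by `tK = c_k·𝟙`, level-`j` labels by `tl j = c_{k−j}·𝟙`
  set tK : Fin d → ℤ := fun _ => (ctrShift L k : ℤ) with htK
  set tl : ℕ → (Fin d → ℤ) := fun j _ => (ctrShift L (k - j) : ℤ) with htl
  have htl' : ∀ j, (fun _ => (ctrShift L (k - j) : ℤ)) = tl j := fun j => rfl
  simp only [htl'] at h
  -- the label dictionary
  have hlab : ∀ j, j ≤ k → ∀ x : Fin d → ℤ, blockMap (L ^ j) x = flmZ L j (x - tK) + tl j := by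
    intro j hj x
    rw [blockMap_pow_eq_flm, ← flm_add_ctrShift hL hj (x - tK), sub_add_cancel]
  -- the translated index sets and the two bijections
  let S' : Finset (Fin d → ℤ) := S.image fun x => x + tK
  have hS'mem : ∀ y, y ∈ S' ↔ y - tK ∈ S := by
    intro y
    simp only [S', Finset.mem_image]
    constructor
    · rintro ⟨x, hx, rfl⟩; rwa [add_sub_cancel_right]
    · intro hy; exact ⟨y - tK, hy, sub_add_cancel y tK⟩
  have hS' : ∀ y, y ∈ S' ↔ y ∈ (fun x : Fin d → ℤ => x + tK) '' D 0 := by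
    intro y; rw [hS'mem, mem_image_add_iff, hS]
  let eS : ↥S ≃ ↥S' :=
    { toFun := fun x => ⟨x.1 + tK, (hS'mem _).2 (by rw [add_sub_cancel_right]; exact x.2)⟩
      invFun := fun y => ⟨y.1 - tK, (hS'mem _).1 y.2⟩
      left_inv := fun x => Subtype.ext (add_sub_cancel_right x.1 tK)
      right_inv := fun y => Subtype.ext (sub_add_cancel y.1 tK) }
  have eS_symm : ∀ y : ↥S', ((eS.symm y : ↥S) : Fin d → ℤ) = y.1 - tK := fun _ => rfl
  have eS_app : ∀ x : ↥S, ((eS x : ↥S') : Fin d → ℤ) = x.1 + tK := fun _ => rfl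
  let B' : Finset (ℕ × (Fin d → ℤ)) := B.image fun p => (p.1, p.2 + tl p.1)
  have hB'mem : ∀ q, q ∈ B' ↔ (q.1, q.2 - tl q.1) ∈ B := by
    intro q
    simp only [B', Finset.mem_image]
    constructor
    · rintro ⟨p, hp, rfl⟩; simpa only [add_sub_cancel_right] using hp
    · intro hq; exact ⟨_, hq, by simp only [sub_add_cancel]⟩
  have hB' : ∀ q, q ∈ B' ↔ q.1 ≤ n ∧ q.2 ∈ (fun z : Fin d → ℤ => z + tl q.1) '' Λ q.1 := by
    intro q; rw [hB'mem, hB, mem_image_add_iff]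
  let eB : ↥B ≃ ↥B' :=
    { toFun := fun p => ⟨(p.1.1, p.1.2 + tl p.1.1), (hB'mem _).2 (by simpa only [add_sub_cancel_right] using p.2)⟩
      invFun := fun q => ⟨(q.1.1, q.1.2 - tl q.1.1), (hB'mem _).1 q.2⟩
      left_inv := fun p => Subtype.ext (by simp only [add_sub_cancel_right])
      right_inv := fun q => Subtype.ext (by simp only [sub_add_cancel]) }
  have eB_symm1 : ∀ q : ↥B', ((eB.symm q : ↥B) : ℕ × (Fin d → ℤ)).1 = q.1.1 := fun _ => rfl
  have eB_symm2 : ∀ q : ↥B', ((eB.symm q : ↥B) : ℕ × (Fin d → ℤ)).2 = q.1.2 - tl q.1.1 := fun _ => rfl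
  have eB_app : ∀ p : ↥B, ((eB p : ↥B') : ℕ × (Fin d → ℤ)) = (p.1.1, p.1.2 + tl p.1.1) := fun _ => rfl
  -- the translated kernel and its defining equation in ENGINE letters
  let K' : (Fin d → ℤ) → (Fin d → ℤ) → ℝ := fun x z => K (x - tK) (z - tK)
  have hK' : ∀ x z, K' x z =
      ((η ^ 2)⁻¹ * ∑ μ : Fin d, ((2 : ℝ) * (if z = x then (1 : ℝ) else 0) - (if z = x + e μ then (1 : ℝ) else 0)
        - (if z = x - e μ then (1 : ℝ) else 0))) +
      (∑ j ∈ Finset.range (n + 1), (if blockMap (L ^ j) x ∈ (fun y : Fin d → ℤ => y + tl j) '' Λ j ∧ blockMap (L ^ j) z = blockMap (L ^ j) x then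
        w j * ((((L : ℝ) ^ d)⁻¹) ^ j) ^ 2 else 0)) := by
    intro x z
    show K (x - tK) (z - tK) = _
    rw [hK]
    congr 1
    · congr 1
      refine Finset.sum_congr rfl fun μ _ => ?_
      rw [ite_eq_ite_of_iff (sub_left_inj : z - tK = x - tK ↔ z = x),
        ite_eq_ite_of_iff (show z - tK = x - tK + e μ ↔ z = x + e μ by rw [sub_add_eq_add_sub, sub_left_inj]),
        ite_eq_ite_of_iff (show z - tK = x - tK - e μ ↔ z = x - e μ by rw [sub_right_comm, sub_left_inj])]
    · refine Finset.sum_congr rfl fun j hj => ?_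
      have hjk : j ≤ k := (Nat.lt_succ_iff.mp (Finset.mem_range.mp hj)).trans hnk
      refine ite_eq_ite_of_iff ?_ _ _
      rw [hlab j hjk x, hlab j hjk z, add_mem_image_add_iff, add_left_inj]
  -- the translated matrices are the record's, reindexed
  have hT' : T.submatrix ⇑eS.symm ⇑eS.symm = Matrix.of (fun x z : ↥S' => K' x.1 z.1) := by
    ext x z
    rw [hT, Matrix.submatrix_apply, Matrix.of_apply, Matrix.of_apply, eS_symm, eS_symm]
  have hQ' : Q.submatrix ⇑eB.symm ⇑eS.symm = Matrix.of (fun (q : ↥B') (z : ↥S') =>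
      if blockMap (L ^ q.1.1) z.1 = q.1.2 then ((((L : ℝ)) ^ d)⁻¹) ^ q.1.1 else 0) := by
    ext q z
    have hqn : q.1.1 ≤ k := ((hB' q.1).1 q.2).1.trans hnk
    rw [hQ, Matrix.submatrix_apply, Matrix.of_apply, Matrix.of_apply, eB_symm1, eB_symm2, eS_symm]
    exact ite_eq_ite_of_iff (by rw [hlab _ hqn z.1, eq_sub_iff_add_eq]) _ _
  -- the engine block on the translated presentation
  obtain ⟨R1, R2, R3⟩ := h S' hS' B' hB' K' hK' _ hT' _ hQ'
  -- reindexing identities for the three operators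
  have hE₁ : (T.submatrix ⇑eS.symm ⇑eS.symm)⁻¹ = T⁻¹.submatrix ⇑eS.symm ⇑eS.symm := Matrix.inv_submatrix_equiv T eS.symm eS.symm
  have hE₂ : (T.submatrix ⇑eS.symm ⇑eS.symm)⁻¹ * ((T.submatrix ⇑eS.symm ⇑eS.symm)⁻¹ * (Q.submatrix ⇑eB.symm ⇑eS.symm)ᵀ) *
      ((Q.submatrix ⇑eB.symm ⇑eS.symm) * (T.submatrix ⇑eS.symm ⇑eS.symm)⁻¹ * (T.submatrix ⇑eS.symm ⇑eS.symm)⁻¹ *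
        (Q.submatrix ⇑eB.symm ⇑eS.symm)ᵀ)⁻¹ =
      (T⁻¹ * (T⁻¹ * Qᵀ) * (Q * T⁻¹ * T⁻¹ * Qᵀ)⁻¹).submatrix ⇑eS.symm ⇑eB.symm := by
    simp only [Matrix.transpose_submatrix, Matrix.inv_submatrix_equiv, Matrix.submatrix_mul_equiv]
  have hE₃ : (T.submatrix ⇑eS.symm ⇑eS.symm)⁻¹ * ((Q.submatrix ⇑eB.symm ⇑eS.symm)ᵀ *
      (((Q.submatrix ⇑eB.symm ⇑eS.symm) * (T.submatrix ⇑eS.symm ⇑eS.symm)⁻¹ * (T.submatrix ⇑eS.symm ⇑eS.symm)⁻¹ *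
        (Q.submatrix ⇑eB.symm ⇑eS.symm)ᵀ)⁻¹ * ((Q.submatrix ⇑eB.symm ⇑eS.symm) * (T.submatrix ⇑eS.symm ⇑eS.symm)⁻¹))) =
      (T⁻¹ * (Qᵀ * ((Q * T⁻¹ * T⁻¹ * Qᵀ)⁻¹ * (Q * T⁻¹)))).submatrix ⇑eS.symm ⇑eS.symm := by
    simp only [Matrix.transpose_submatrix, Matrix.inv_submatrix_equiv, Matrix.submatrix_mul_equiv]
  -- bookkeeping for the translated bounds
  have hwt : ∀ (ρ' : ↥S → ℝ) (r : ℝ), (∀ j, j ≤ n → ∀ z : ↥S, z.1 ∈ D j → wt L η j ^ 2 * |ρ' z| ≤ r) →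
      ∀ j, j ≤ n → ∀ z : ↥S', z.1 ∈ (fun x : Fin d → ℤ => x + tK) '' D j → wt L η j ^ 2 * |ρ' (eS.symm z)| ≤ r := by
    intro ρ' r hρ j hj z hz
    exact hρ j hj (eS.symm z) (by rw [eS_symm]; exact (mem_image_add_iff _ _ _).1 hz)
  have hsupp : ∀ φ : (Fin d → ℤ) → ℝ, (∀ x, x ∉ D 0 → φ x = 0) →
      ∀ x, x ∉ (fun y : Fin d → ℤ => y + tK) '' D 0 → φ (x - tK) = 0 := by
    intro φ hφ x hx
    exact hφ _ fun h' => hx ((mem_image_add_iff _ _ _).2 h')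
  have hside : ∀ j (p : (Fin d → ℤ) × Fin d), p ∈ {b : (Fin d → ℤ) × Fin d | SideTouches (D j) b.1 b.2} →
      (p.1 + tK, p.2) ∈ {b : (Fin d → ℤ) × Fin d | SideTouches ((fun x : Fin d → ℤ => x + tK) '' D j) b.1 b.2} := by
    intro j p hp
    exact (sideTouches_image_add_iff (D j) tK p.1 p.2).2 hp
  have hgrad : ∀ (φ : (Fin d → ℤ) → ℝ) (p : (Fin d → ℤ) × Fin d),
      (fun y => φ (y - tK)) ((p.1 + tK, p.2).1 + e (p.1 + tK, p.2).2) - (fun y => φ (y - tK)) (p.1 + tK, p.2).1 = φ (p.1 + e p.2) - φ p.1 := by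
    intro φ p
    simp only [add_right_comm p.1 tK (e p.2), add_sub_cancel_right]
  refine ⟨?_, ?_, ?_⟩
  · -- REAL-1
    intro ρ' r hr hρ φ hφ hφT
    obtain ⟨h1, h2⟩ := R1 (fun z => ρ' (eS.symm z)) r hr (hwt ρ' r hρ) (fun y => φ (y - tK)) (hsupp φ hφ) (by
      intro v
      show φ (v.1 - tK) = _
      rw [hE₁, ← eS_symm, hφT (eS.symm v), ← Equiv.sum_comp eS.symm]
      simp only [Matrix.submatrix_apply])
    refine ⟨fun x => by simpa only [add_sub_cancel_right] using h1 (x + tK), fun j hj p hp => ?_⟩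
    have := h2 j hj (p.1 + tK, p.2) (hside j p hp)
    rwa [hgrad] at this
  · -- REAL-2
    intro X s hs hX φ hφ hφH
    obtain ⟨h1, h2, h3⟩ := R2 (fun q => X (eB.symm q)) s hs (fun q => hX _) (fun y => φ (y - tK)) (hsupp φ hφ) (by
      intro v
      show φ (v.1 - tK) = _
      rw [hE₂, ← eS_symm, hφH (eS.symm v), ← Equiv.sum_comp eB.symm]
      simp only [Matrix.submatrix_apply])
    refine ⟨fun x => by simpa only [add_sub_cancel_right] using h1 (x + tK), fun j hj p hp => ?_, fun j hj x hx => ?_⟩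
    · have := h2 j hj (p.1 + tK, p.2) (hside j p hp)
      rwa [hgrad] at this
    · have := h3 j hj (x + tK) ((add_mem_image_add_iff _ _ _).2 hx)
      simpa only [add_sub_cancel_right, add_right_comm x tK (e _), add_sub_right_comm x tK (e _)] using this
  · -- REAL-3
    intro ρ' r hr hρ j hj v hv
    have := R3 (fun z => ρ' (eS.symm z)) r hr (hwt ρ' r hρ) j hj (eS v) (by rw [eS_app]; exact (add_mem_image_add_iff _ _ _).2 hv)
    rw [hE₃, Equiv.symm_apply_apply, ← Equiv.sum_comp eS] at this
    simpa only [Matrix.submatrix_apply, Equiv.symm_apply_apply] using this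

end Literature.MathematicalPhysics.QuantumFieldTheory.Balaban1983to89.B8Real123FlatTranslateRec

end

/-! ## Axiom audit (gate whitelist: `propext`, `Classical.choice`, `Quot.sound`) -/
#print axioms Literature.MathematicalPhysics.QuantumFieldTheory.Balaban1983to89.B8Real123FlatTranslateRec.real123Block_translate
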